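import Literature.MathematicalPhysics.KineticTheory.InfiniteChainShiftInvariantUniqueness
import Literature.MathematicalPhysics.KineticTheory.InfiniteChainSuperstableDynamics
import HarnessLib

/-!
# Stub U `stub_bmRigidity` of line `Sketch`, crux `EmbeddedDrudeMourre.DrudeDissolution`
(stmt-AtomisticToContinuum-12593): rigidity of the Buttà–Marchioro class

For the pinned anharmonic chain `pinnedChain ω₂ lam β γ` (all parameters `> 0`) and `T > 0`: two DLR
states `μ₁, μ₂` at `T` invariant under the unit shift, and two infinite-volume dynamics `D₁, D₂`
(`InfiniteChainDynamics`) whose carriers both EQUAL Buttà–Marchioro's good set `bmGood`, `D₁`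
preserving `μ₁`, have

* the same state, `μ₁ = μ₂` — uniqueness of the shift-invariant DLR state of the pinned chain
  (`OscillatorChain.eq_of_isChainGibbsMeasure_of_isShiftInvariant_pinnedChain`); shift invariance
  `IsShiftInvariant μ` (`μ.map shift = μ`, `shift σ = fun x => σ (x + 1)`) IS the `map_eq` field of the
  `MeasurePreserving` hypothesis for the unit shift;
* the same flow on `bmGood` — the `D₂`-orbit of `σ ∈ bmGood = D₂.carrier` stays in
  `bmGood = D₁.carrier` and solves the equations of motion (`D₂.isSolution`), so `D₁.unique`
  identifies it with the `D₁`-orbit of `D₂.flow 0 σ = σ` (`D₂.flow_zero`);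
* the same summed current autocorrelation `C_T(t) = ∑_x ∫ j_0 · (j_x ∘ φ_t) dμ₁` at every time —
  `μ₁`-a.e. `σ ∈ D₁.carrier = bmGood` (`PreservesMeasure.1`), where the integrands agree
  (`integral_congr_ae`, `tsum_congr`).

No named fact is used; everything is in the tree.

## Contents
* `bmRigidity_flow_eq_of_carrier_subset` — two dynamics agree on the carrier of the second as soon
  as it is contained in the carrier of the first;
* `bmRigidity_currentCorrelation_eq` — dynamics agreeing `μ`-a.e. have the same `currentCorrelation μ`;
* `stub_bmRigidity` — the registered stub, verbatim.
-/

noncomputable section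

open MeasureTheory Filter Set

namespace Summit.AtomisticToContinuum.FouriersLaw.Theorems.DrudeDissolution.LineSketch

open Literature.MathematicalPhysics.KineticTheory.HeatConduction

/-- **Flows agree on a common invariant set.** If the carrier of `D₂` is contained in the carrier
of `D₁`, then for every `σ ∈ D₂.carrier` the two flows agree at `σ` at all times: the `D₂`-orbit of
`σ` stays in `D₂.carrier ⊆ D₁.carrier` and solves the equations of motion, hence (`D₁.unique`) it is
the `D₁`-orbit of its time-`0` value `D₂.flow 0 σ = σ`. [folklore] -/
theorem bmRigidity_flow_eq_of_carrier_subset {P : OscillatorChain}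
    (D₁ D₂ : InfiniteChainDynamics P) (h : D₂.carrier ⊆ D₁.carrier) (t : ℝ) {σ : ChainConfig}
    (hσ : σ ∈ D₂.carrier) : D₁.flow t σ = D₂.flow t σ := by
  have hu := D₁.unique (fun s => D₂.flow s σ) (fun s => h (D₂.flow_mem hσ s))
    (D₂.isSolution σ hσ) t
  -- `hu : D₂.flow t σ = D₁.flow t (D₂.flow 0 σ)`
  rw [D₂.flow_zero σ hσ] at hu
  exact hu.symm

/-- **Dynamics agreeing almost everywhere have the same summed current autocorrelation.** If
`μ`-a.e. `σ ∈ D₁.carrier` and the flows of `D₁`, `D₂` agree on `D₁.carrier`, then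
`D₁.currentCorrelation μ t = D₂.currentCorrelation μ t` for every `t` (the `x`-th integrands
`j_0(σ) j_x(φ_t σ)` agree `μ`-a.e.; `integral_congr_ae`, `tsum_congr`). [folklore] -/
theorem bmRigidity_currentCorrelation_eq {P : OscillatorChain}
    (D₁ D₂ : InfiniteChainDynamics P) (μ : Measure ChainConfig)
    (hae : ∀ᵐ σ ∂μ, σ ∈ D₁.carrier)
    (hflow : ∀ (t : ℝ) (σ : ChainConfig), σ ∈ D₁.carrier → D₁.flow t σ = D₂.flow t σ) (t : ℝ) :
    D₁.currentCorrelation μ t = D₂.currentCorrelation μ t := by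
  unfold InfiniteChainDynamics.currentCorrelation
  refine tsum_congr fun x => integral_congr_ae ?_
  filter_upwards [hae] with σ hσ
  rw [hflow t σ hσ]

/-- **U `stub_bmRigidity` — RIGIDITY OF THE BUTTÀ–MARCHIORO CLASS.** For `pinnedChain ω₂ lam β γ`
(all `> 0`), `T > 0`, two DLR states `μ₁, μ₂` at `T` invariant under the unit shift and two
infinite-volume dynamics `D₁, D₂` with carrier EQUAL to BM's good set `bmGood`, `D₁` preserving `μ₁`:
`μ₁ = μ₂` (uniqueness of the shift-invariant DLR state,
`eq_of_isChainGibbsMeasure_of_isShiftInvariant_pinnedChain`, with `IsShiftInvariant μ := h.map_eq`), the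
flows agree on `bmGood` (`D₁.unique` applied to the `D₂`-orbit of `σ ∈ bmGood = D₂.carrier`, which stays
in `bmGood = D₁.carrier` and solves the equations by `D₂.isSolution`, with `D₂.flow_zero`), and the
summed current autocorrelations coincide at every time (`currentCorrelation` is a `tsum` over `x` of
integrals whose integrands agree `μ₁`-a.e., since `μ₁`-a.e. `σ ∈ D₁.carrier = bmGood` by
`PreservesMeasure.1`; `integral_congr_ae`, `tsum_congr`). [folklore] -/
theorem stub_bmRigidity :
    ∀ ω₂ lam β γ : ℝ, 0 < ω₂ → 0 < lam → 0 < β → 0 < γ →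
      ∀ (T : ℝ) (μ₁ μ₂ : MeasureTheory.Measure Literature.MathematicalPhysics.KineticTheory.HeatConduction.ChainConfig)
        (D₁ D₂ : Literature.MathematicalPhysics.KineticTheory.HeatConduction.InfiniteChainDynamics
          (Literature.MathematicalPhysics.KineticTheory.HeatConduction.pinnedChain ω₂ lam β γ)),
        0 < T →
        (Literature.MathematicalPhysics.KineticTheory.HeatConduction.pinnedChain ω₂ lam β γ).IsChainGibbsMeasure T μ₁ →
        (Literature.MathematicalPhysics.KineticTheory.HeatConduction.pinnedChain ω₂ lam β γ).IsChainGibbsMeasure T μ₂ →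
        MeasureTheory.MeasurePreserving
          (fun σ : Literature.MathematicalPhysics.KineticTheory.HeatConduction.ChainConfig => fun i : ℤ => σ (i + 1)) μ₁ μ₁ →
        MeasureTheory.MeasurePreserving
          (fun σ : Literature.MathematicalPhysics.KineticTheory.HeatConduction.ChainConfig => fun i : ℤ => σ (i + 1)) μ₂ μ₂ →
        D₁.carrier = (Literature.MathematicalPhysics.KineticTheory.HeatConduction.pinnedChain ω₂ lam β γ).bmGood →
        D₂.carrier = (Literature.MathematicalPhysics.KineticTheory.HeatConduction.pinnedChain ω₂ lam β γ).bmGood →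
        D₁.PreservesMeasure μ₁ →
        μ₁ = μ₂ ∧
          (∀ (t : ℝ) (σ : Literature.MathematicalPhysics.KineticTheory.HeatConduction.ChainConfig),
            σ ∈ (Literature.MathematicalPhysics.KineticTheory.HeatConduction.pinnedChain ω₂ lam β γ).bmGood →
              D₁.flow t σ = D₂.flow t σ) ∧
          ∀ t : ℝ, D₁.currentCorrelation μ₁ t = D₂.currentCorrelation μ₂ t := by
  intro ω₂ lam β γ hω hl hβ _hγ T μ₁ μ₂ D₁ D₂ hT hG₁ hG₂ hshift₁ hshift₂ hD₁ hD₂ hP₁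
  -- (1) shift invariance of `μᵢ` is the `MeasurePreserving` hypothesis for the unit shift
  have hS₁ : IsShiftInvariant μ₁ := hshift₁.map_eq
  have hS₂ : IsShiftInvariant μ₂ := hshift₂.map_eq
  -- uniqueness of the shift-invariant DLR state of the pinned chain
  have hμ : μ₁ = μ₂ :=
    OscillatorChain.eq_of_isChainGibbsMeasure_of_isShiftInvariant_pinnedChain γ hω hl.le hβ.le hT
      hG₁ hS₁ hG₂ hS₂
  -- (2) the flows agree on `bmGood = D₁.carrier = D₂.carrier`
  have h₂₁ : D₂.carrier ⊆ D₁.carrier := by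
    intro σ hσ
    rw [hD₁]
    rw [hD₂] at hσ
    exact hσ
  have hflow : ∀ (t : ℝ) (σ : ChainConfig), σ ∈ (pinnedChain ω₂ lam β γ).bmGood →
      D₁.flow t σ = D₂.flow t σ := by
    intro t σ hσ
    have hσ₂ : σ ∈ D₂.carrier := by
      rw [hD₂]
      exact hσ
    exact bmRigidity_flow_eq_of_carrier_subset D₁ D₂ h₂₁ t hσ₂
  -- (3) the summed current autocorrelations coincide
  refine ⟨hμ, hflow, fun t => ?_⟩
  rw [← hμ]
  refine bmRigidity_currentCorrelation_eq D₁ D₂ μ₁ hP₁.1 (fun s σ hσ => hflow s σ ?_) t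
  rw [hD₁] at hσ
  exact hσ

end Summit.AtomisticToContinuum.FouriersLaw.Theorems.DrudeDissolution.LineSketch

end
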